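import Mathlib
import Literature.RingTheory.MvPolynomial.RuppertMatrix
import HarnessLib

/-!
# Equal multiplicity ⇒ the strict transform is EXACT in the chart `X₁ ↦ X₀X₁` (card 4 `equigeneric-foresee`, hinge (c))

[OURS · L1 ★L-G4 W4.5 (b)] Helper for the crux `EquisingularLiftNat` (stmt-ResolutionOfSingularities-20038; route
`EquisingularLift`, chain w45b). Proves VERBATIM the sorried statement `ExactChartOfDoublePoint` of res-L1-w45b-idea-2's
`Sketch-L1-idea-2.lean` v5 (sha16 2c10f18d963ef2f6, l.214; card 4 `equigeneric-foresee` = `idea-equigeneric-foresee.md`, the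
third local hinge of the DOUBLE-POINT FORESEE LEMMA; res-L1-w45b-tri-2 TRIAGE §9.1: «hinges (a)(b)(c) TRUE, M-sized»; (a)/(b) are
res-type-018's `…SectionHinges`). NOT a statement of the manuscript under review (cell `res-hironaka`); AI-written kernel lemma,
weaker than expert review.

**The statement (informal).** Over any commutative ring `O` with an ideal `I` (read: a DVR and its maximal ideal), let
`f ∈ O[X₀, X₁]` lie in `(X₀, X₁)²` (the zero section is at least a double point of the generic fibre) while its reduction
`f̄ ∈ (O/I)[X₀, X₁]` is NOT in `(X₀, X₁)³` (the special fibre has multiplicity exactly `2`). Then in the chart `X₁ ↦ X₀X₁` of the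
blow-up of the section, `f(X₀, X₀X₁) = X₀² · f₁` with `X₀ ∤ f̄₁`: the reduction of the strict transform IS the strict transform
of the reduction (no extra copy of the exceptional line).

**Proof.** Monomial bookkeeping: `(X₀, X₁)ⁿ = idealOfVars²` membership is «all monomials of degree `< n` have zero coefficient»
(Mathlib `MvPolynomial.mem_pow_idealOfVars_iff'`); the chart sends `X₀^a X₁^b ↦ X₀^{a+b} X₁^b`, so `f₁ = Σ c_{ab} X₀^{a+b−2} X₁^b`
explicitly, and the `X₀`-free coefficient of `X₁^b` in `f₁` is `c_{2−b, b}` — one of which survives modulo `I`.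
-/

set_option linter.dupNamespace false

noncomputable section

open MvPolynomial

namespace Summit.ResolutionOfSingularities.ResolutionOfSingularities.Theorems.EquisingularLift.Foresee

section Helpers

variable {O : Type} [CommRing O]

/-- `(X₀, X₁) = idealOfVars` in two variables. [folklore] -/
theorem span_X_pair_eq_idealOfVars :
    (Ideal.span {(X 0 : MvPolynomial (Fin 2) O), X 1}) = idealOfVars (Fin 2) O := by
  change Ideal.span _ = Ideal.span _
  congr 1
  ext p
  simp only [Set.mem_insert_iff, Set.mem_singleton_iff, Set.mem_range]
  constructor
  · rintro (rfl | rfl)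
    · exact ⟨0, rfl⟩
    · exact ⟨1, rfl⟩
  · rintro ⟨i, rfl⟩
    fin_cases i
    · exact Or.inl rfl
    · exact Or.inr rfl


/-- `X₀² · X^{(Finsupp.single (0 : Fin 2) (m 0 + m 1 - 2) + Finsupp.single (1 : Fin 2) (m 1))} = X₀^{a+b} X₁^b` at the exponent level, for `a + b ≥ 2`. [folklore] -/
theorem single_two_add_chartExp {m : Fin 2 →₀ ℕ} (hm : 2 ≤ m 0 + m 1) :
    (Finsupp.single (0 : Fin 2) 2 : Fin 2 →₀ ℕ) + (Finsupp.single (0 : Fin 2) (m 0 + m 1 - 2) + Finsupp.single (1 : Fin 2) (m 1)) =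
      Finsupp.single (0 : Fin 2) (m 0 + m 1) + Finsupp.single (1 : Fin 2) (m 1) := by
  refine Finsupp.ext fun i => ?_
  simp only [Finsupp.coe_add, Pi.add_apply, Finsupp.single_apply]
  fin_cases i
  · simp only [Fin.zero_eta, Fin.isValue, ↓reduceIte, one_ne_zero, add_zero]
    omega
  · simp

/-- The chart substitution on a monomial: `X₀^a X₁^b ↦ X₀^{a+b} X₁^b`. [folklore] -/
theorem bind₁_chart_monomial (m : Fin 2 →₀ ℕ) (c : O) :
    bind₁ (fun i : Fin 2 => if i = 0 then (X 0 : MvPolynomial (Fin 2) O) else X 0 * X 1) (monomial m c) =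
      monomial (Finsupp.single (0 : Fin 2) (m 0 + m 1) + Finsupp.single (1 : Fin 2) (m 1)) c := by
  rw [bind₁_monomial,
    Finset.prod_subset (Finset.subset_univ m.support) (fun i _ hi => by
      rw [Finsupp.notMem_support_iff.mp hi, pow_zero]),
    Fin.prod_univ_two]
  simp only [Fin.isValue, if_true, one_ne_zero, if_false]
  have h : (X 0 : MvPolynomial (Fin 2) O) ^ (m 0) * (X 0 * X 1) ^ (m 1) = X 0 ^ (m 0 + m 1) * X 1 ^ (m 1) := by ring
  rw [h, X_pow_eq_monomial, X_pow_eq_monomial, monomial_mul, mul_one, C_mul_monomial, mul_one]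

/-- **Chart identity**: if every monomial of `f` has degree `≥ 2` then `f(X₀, X₀X₁) = X₀² · f₁`. [folklore] -/
theorem bind₁_chart_eq_X_sq_mul_chartQuot (f : MvPolynomial (Fin 2) O) (hf : ∀ m ∈ f.support, 2 ≤ m 0 + m 1) :
    bind₁ (fun i : Fin 2 => if i = 0 then (X 0 : MvPolynomial (Fin 2) O) else X 0 * X 1) f =
      X 0 ^ 2 * (∑ m ∈ f.support, monomial (Finsupp.single (0 : Fin 2) (m 0 + m 1 - 2) + Finsupp.single (1 : Fin 2) (m 1)) (coeff m f)) := by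
  conv_lhs => rw [f.as_sum]
  rw [map_sum, Finset.mul_sum]
  refine Finset.sum_congr rfl fun m hm => ?_
  rw [bind₁_chart_monomial, X_pow_eq_monomial, monomial_mul, one_mul, single_two_add_chartExp (hf m hm)]

/-- The `X₀`-free coefficients of `f₁`: `coeff (0, b) f₁ = coeff (2 − b, b) f` (for `b ≤ 2`), read at the exponent `m⋆`
of degree `2`: `coeff (single 1 (m⋆ 1)) f₁ = coeff m⋆ f`. [folklore] -/
theorem coeff_single_one_chartQuot (f : MvPolynomial (Fin 2) O) (hf : ∀ m ∈ f.support, 2 ≤ m 0 + m 1)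
    (ms : Fin 2 →₀ ℕ) (hms : ms 0 + ms 1 = 2) :
    coeff (Finsupp.single (1 : Fin 2) (ms 1)) ((∑ m ∈ f.support, monomial (Finsupp.single (0 : Fin 2) (m 0 + m 1 - 2) + Finsupp.single (1 : Fin 2) (m 1)) (coeff m f))) = coeff ms f := by
  classical
  rw [coeff_sum]
  simp only [coeff_monomial]
  have key : ∀ m ∈ f.support, ((Finsupp.single (0 : Fin 2) (m 0 + m 1 - 2) + Finsupp.single (1 : Fin 2) (m 1)) = Finsupp.single (1 : Fin 2) (ms 1)) ↔ m = ms := by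
    intro m hm
    constructor
    · intro h
      have h0 := congrArg (fun e => e 0) h
      have h1 := congrArg (fun e => e 1) h
      simp only [Finsupp.coe_add, Pi.add_apply, Finsupp.single_apply, Fin.isValue, one_ne_zero,
        if_false, if_true, zero_ne_one, add_zero, zero_add] at h0 h1
      have hm2 := hf m hm
      ext i
      fin_cases i
      · show m 0 = ms 0
        omega
      · show m 1 = ms 1
        exact h1
    · intro h
      rw [h]
      have hz : ms 0 + ms 1 - 2 = 0 := by omega
      rw [hz, Finsupp.single_zero, zero_add]
  rw [Finset.sum_congr rfl fun m hm => by rw [if_congr (key m hm) rfl rfl]]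
  by_cases hmem : ms ∈ f.support
  · rw [Finset.sum_eq_single ms (fun m _ hne => if_neg hne) (fun h => absurd hmem h), if_pos rfl]
  · rw [Finset.sum_eq_zero (fun m hm => if_neg (by rintro rfl; exact hmem hm))]
    exact (notMem_support_iff.mp hmem).symm

/-- A multiple of `X₀` has no `X₀`-free monomials. [folklore] -/
theorem coeff_single_one_eq_zero_of_X_dvd {R : Type} [CommRing R] {g : MvPolynomial (Fin 2) R}
    (h : (X 0 : MvPolynomial (Fin 2) R) ∣ g) (b : ℕ) : coeff (Finsupp.single (1 : Fin 2) b) g = 0 := by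
  obtain ⟨q, rfl⟩ := h
  rw [coeff_X_mul']
  simp

end Helpers

/-- **Card 4 `equigeneric-foresee`, hinge (c): equal multiplicity ⇒ the strict transform is EXACT (chart form)**
(res-L1-w45b-idea-2, Sketch-L1-idea-2.lean v5 l.214, VERBATIM). `f ∈ (X₀, X₁)²` (the zero section is at least a double point
of the generic fibre) and the special fibre has multiplicity EXACTLY `2` at the origin (`f̄ ∉ (X₀, X₁)³`). Then in the chart
`X₁ ↦ X₀·X₁` of the blow-up of the section, `f(X₀, X₀X₁) = X₀² · f₁` and the reduction of `f₁` is not divisible by `X₀` —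
`f̄₁` IS the strict transform of `f̄` (no extra copy of the exceptional line). OURS; AI-written. -/
theorem ExactChartOfDoublePoint :
  ∀ (O : Type) [CommRing O] (I : Ideal O) (f : MvPolynomial (Fin 2) O),
    f ∈ (Ideal.span {(MvPolynomial.X 0 : MvPolynomial (Fin 2) O), MvPolynomial.X 1}) ^ 2 →
    MvPolynomial.map (Ideal.Quotient.mk I) f ∉
      (Ideal.span {(MvPolynomial.X 0 : MvPolynomial (Fin 2) (O ⧸ I)), MvPolynomial.X 1}) ^ 3 →
    ∃ f₁ : MvPolynomial (Fin 2) O,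
      MvPolynomial.bind₁ (fun i : Fin 2 => if i = 0 then MvPolynomial.X 0 else MvPolynomial.X 0 * MvPolynomial.X 1) f
        = MvPolynomial.X 0 ^ 2 * f₁ ∧
      ¬ ((MvPolynomial.X 0 : MvPolynomial (Fin 2) (O ⧸ I)) ∣ MvPolynomial.map (Ideal.Quotient.mk I) f₁) := by
  intro O _ I f h2 h3
  rw [span_X_pair_eq_idealOfVars, mem_pow_idealOfVars_iff'] at h2
  rw [span_X_pair_eq_idealOfVars, mem_pow_idealOfVars_iff'] at h3
  push Not at h3
  obtain ⟨ms, hms3, hmsne⟩ := h3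
  rw [coeff_map] at hmsne
  -- every monomial of `f` has degree `≥ 2`
  have hsupp : ∀ m ∈ f.support, 2 ≤ m 0 + m 1 := by
    intro m hm
    by_contra hlt
    push Not at hlt
    exact (mem_support_iff.mp hm) (h2 m (by rw [Literature.RingTheory.MvPolynomial.Ruppert.degree_fin_two]; exact hlt))
  -- the surviving coefficient has degree exactly `2`
  have hms2 : ms 0 + ms 1 = 2 := by
    have hge : 2 ≤ ms 0 + ms 1 := by
      by_contra hlt
      push Not at hlt
      apply hmsne
      rw [h2 ms (by rw [Literature.RingTheory.MvPolynomial.Ruppert.degree_fin_two]; exact hlt), map_zero]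
    rw [Literature.RingTheory.MvPolynomial.Ruppert.degree_fin_two] at hms3
    omega
  refine ⟨(∑ m ∈ f.support, monomial (Finsupp.single (0 : Fin 2) (m 0 + m 1 - 2) + Finsupp.single (1 : Fin 2) (m 1)) (coeff m f)), bind₁_chart_eq_X_sq_mul_chartQuot f hsupp, fun hdiv => hmsne ?_⟩
  have h0 := coeff_single_one_eq_zero_of_X_dvd hdiv (ms 1)
  rw [coeff_map] at h0
  rw [← coeff_single_one_chartQuot f hsupp ms hms2]
  exact h0

end Summit.ResolutionOfSingularities.ResolutionOfSingularities.Theorems.EquisingularLift.Foresee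

end
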